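import Literature.AnabelianGeometry.EtaleTheta.Discharge.Sec2Cor219iiiLevelCompatOfHearts
import Literature.AnabelianGeometry.EtaleTheta.Discharge.Sec2Cor219iiiHgenParityAtModelChi
import HarnessLib

/-!
# [EtTh] Cor. 2.19 (iii), tower form — (b2) PERIODICITY of `conjRoot` AT THE TATE MODEL `ThetaSetting.modelχq p i j`
# at EVERY level (no parity): `red_M ∘ conjRoot (σ^M) f = red_M ∘ f` on ALL of `Π^tp_Ÿ̲̲` (proof-only; row
# «COR219III-B2-PERIODICITY@modelTate», K-L6 «COR219III-M1b» / M2)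

DELTA vs abc-iut-f-142's `Sec2Cor219iiiLevelCompatOfHearts` (p492018) and `Sec2Cor219iiiLevelCompat` (p491632): those
files prove the GENERIC (b2) engine — the quadratic law, the vanishing `red_M ∘ conjRoot (σ^M) f = red_M ∘ f` at ODD `M`
(`red_conjRoot_pow_eq_of_odd`), the SQUARE VARIANT at any parity UNDER THE HYPOTHESIS that the iterated-commutator class
`e = θ[σ⁻¹; σ⁻¹kσk⁻¹]` is a square in `l·Δ_Θ` (`red_conjRoot_pow_eq_of_sq`), and the congruence transfer at odd `M`
(`red_conjRoot_zpow_eq_of_modEq`).  THIS FILE is the modelχq PACKAGING ONLY (abc-iut-L6-lead gen 8, §F v1.19ds (A2),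
scope guard): at the stage-2 Tate model the square hypothesis is DISCHARGED for every geometric `σ ∈ Π^tp_X̲̲` and EVERY
`k ∈ Π^tp_Ÿ̲̲` (arithmetic included) by abc-iut-L1-t6's `exists_sq_eq_toTheta_comm_modelχq` (p487040), so the vanishing and the
congruence transfer hold at EVERY level `M`, even or odd — exactly the even-lower-level case p492018 leaves open.

S. Mochizuki, *The étale theta function and its Frobenioid-theoretic manifestations*, Publ. RIMS **45** (2009) [EtTh],
§2, Cor. 2.19 (iii), PRIMS PDF p. 65 («by allowing `N` to vary among all [elements of `E`] … compatible»); §1 p. 12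
(«`Δ^Θ_X` … central extension», «`Δ_Θ ≅ Ẑ(1)`») [cite: MochizukiEtTh2009, Cor 2.19(iii) p.65].

Cell `abc-iut`, seat abc-iut-w5-d162 (gen 9), K-L6 row «COR219III-B2-PERIODICITY@modelTate» (keyed by abc-iut-L6-lead gen 8,
§F v1.19ds (A2), 2026-08-27; abc-iut-w5-d187 consent), the model-side (b2) input of the LEVEL-WISE knit of
abc-iut-C-hgal-2's `cor219_iii_of_hearts` (p482618) with level-dependent conjugators `x_M := a^{m_M}` (M2; the
constant-conjugator clause (H.b) of `Sec2Cor219iiiAtModelChi` is refuted-at-model by the profinite-inner admissible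
automorphisms `Ad(â^{lv})`, `v ∈ Ẑ ∖ ℤ` — abc-iut-w5-d187 DATUM / row «(β1)-REFUTED-AT-MODEL»).  PROOF-ONLY: no
definition, no instance, no notation, no new named fact; inputs consumed BY NAME — abc-iut-f-142's
`red_conjRoot_pow_eq_of_sq`, `conjRoot_mul_apply`, `conj_mul_inv_mem_GtpYdduu`, `toTheta_conj_mul_inv_mem_DeltaTheta`,
`toTheta_mem_lDeltaTheta_of_mem_Huu`, `ThetaSetting.aug_pow_comm_eq_one` (p491632 / p492018 / p477045),
abc-iut-L1-t6's `SettingModel.exists_sq_eq_toTheta_comm_modelχq` (p487040), abc-iut's `ThetaSetting.conjNormal_eq_of_aug_eq_one`.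

WHAT IS SHOWN, at `D := ThetaSetting.modelχq p i j hj` (every `i`, every EVEN `j`; datum of record `(i, j) = (1, 2)`), for
EVERY étale-theta datum `E`, EVERY `X̲̲`-choice `C`, every cyclotome tower `τ`, every root cocycle `f`, and `hC`, `h15`:
* §1 `exists_sq_eq_toTheta_conj_comm_modelχq` — for geometric `σ ∈ Π^tp_X̲̲` and ANY `k ∈ Π^tp_Ÿ̲̲`, the class
  `e := θ[σ⁻¹; c₁]`, `c₁ := σ⁻¹kσk⁻¹`, IS A SQUARE `s²`, `s ∈ l·Δ_Θ`: `c₁` is a GEOMETRIC element of `Π^tp_Ÿ̲̲` (normality), so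
  p487040 applies at the pair `(σ, c₁)` (there: `deg σ ∈ l·ℤ` and `ŷ(c₁) ∈ 2Ẑ` since `Π^tp_Ÿ = Π^tp_{Y₂}`).
* §2 **`red_conjRoot_pow_eq_modelχq`** — `red_M (conjRoot (σ^M) f k) = red_M (f k)` for EVERY `M ∈ E` (no parity) and
  **`red_conjRoot_zpow_eq_of_modEq_modelχq`** — `m ≡ m′ (mod M) ⇒ red_M (conjRoot (a^{m′}) f k) = red_M (conjRoot (a^m) f k)`
  for EVERY `M` (abc-iut-f-142's `_of_modEq` argument with §2's vanishing in place of the odd-level one).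
* §3 **`levelCompat_of_compatible_modelχq`** — the (b2) clause of `cor219_iii_of_hearts` VERBATIM at the Tate datum for ANY
  mod-compatible exponent family (`m M′ ≡ m M (mod M)` for `M ∣ M′`), every pair `M ∣ M′`, every `g ∈ Π^tp_Ÿ̲̲`: no parity,
  no `hgen` — the input the level-wise knits (abc-iut-f-142 FILE 4 / abc-iut-L1-t6 FILE 3) cite BY NAME.

HONEST LABEL: statements about the SEMI-SYNTHETIC stage-2 model of OUR typed §1 interface (binder-discharge evidence),
NOT about the tempered fundamental group of a curve; nothing of [EtTh] (refereed) is asserted or denied for a curve; no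
side is taken on [IUTchIII] Cor. 3.12; typed ≠ proved; instantiated ≠ endorsed; nothing here asserts abc proved or refuted.
-/

noncomputable section

namespace Literature.AnabelianGeometry.EtaleTheta

open Literature.AnabelianGeometry.SemiGraphs _root_.Function

/-! ## §0. A generic transfer step (local helper; the public generic form under a squares hypothesis is abc-iut-f-142's (G4)) -/

namespace ThetaSetting.EtaleThetaData.DoubleUnderline

variable {p : ℕ} [Fact p.Prime] {D : ThetaSetting p} {E : D.EtaleThetaData} {l : ℕ}
  (C : E.DoubleUnderline l) {Es : Set ℕ+} (τ : D.CyclotomeTower l Es)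

/-- Local helper (abc-iut-f-142's `red_conjRoot_zpow_eq_of_modEq` argument with the odd-level vanishing replaced by an
ASSUMED vanishing at the level `M` for every power `(a^t)^M` and every point): congruent exponents give the same level-`M`
reduction on all of `Π^tp_Ÿ̲̲`.  Kept `private`: the public generic statement under a squares hypothesis belongs to
abc-iut-f-142's (b2-bis) files; this file only exports the modelχq instances. [cite: MochizukiEtTh2009, Cor 2.19(iii) p.65] -/
private theorem red_conjRoot_zpow_eq_of_modEq_of_vanishing (hC : D.Compat)
    {f : contCocycles D.toTheta D.DeltaTheta C.GtpYdduu} (hf : f ∈ C.rootCocycles hC)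
    (a : C.Huu) (ha : D.aug.toMonoidHom (a : D.PiTemp) = 1) (k : C.GtpYdduu) (M : Es)
    (hvan : ∀ (t : ℤ) (k' : C.GtpYdduu),
      (τ.mod M).red ⟨(C.conjRoot hC ((a ^ t) ^ ((M : ℕ+) : ℕ)) f.1 k' : D.GtpTheta),
          (D.lDeltaTheta_normal l).conj_mem _ (hf.1 _) _⟩ =
        (τ.mod M).red ⟨(f.1 k' : D.GtpTheta), hf.1 _⟩)
    {m m' : ℤ} (hmm' : m ≡ m' [ZMOD ((M : ℕ+) : ℕ)]) :
    (τ.mod M).red ⟨(C.conjRoot hC (a ^ m') f.1 k : D.GtpTheta), (D.lDeltaTheta_normal l).conj_mem _ (hf.1 _) _⟩ =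
      (τ.mod M).red ⟨(C.conjRoot hC (a ^ m) f.1 k : D.GtpTheta), (D.lDeltaTheta_normal l).conj_mem _ (hf.1 _) _⟩ := by
  obtain ⟨t, ht⟩ := (Int.modEq_iff_dvd.1 hmm')
  have hm' : m' = m + t * (((M : ℕ+) : ℕ) : ℤ) := by rw [mul_comm]; omega
  have ham : D.aug.toMonoidHom ((a ^ m : C.Huu) : D.PiTemp) = 1 := by
    rw [Subgroup.coe_zpow, map_zpow, ha, one_zpow]
  -- `conjRoot (a^{m'}) f k = conjRoot ((a^t)^M) f (a^{-m} k a^m)` and `conjRoot (a^m) f k = f (a^{-m} k a^m)`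
  have hdec : (a ^ m' : C.Huu) = a ^ m * (a ^ t) ^ ((M : ℕ+) : ℕ) := by
    rw [hm', zpow_add, zpow_mul, zpow_natCast]
  have key : C.conjRoot hC (a ^ m') f.1 k =
      C.conjRoot hC ((a ^ t) ^ ((M : ℕ+) : ℕ)) f.1 ⟨_, C.conj_mem_GtpYdduu hC (a ^ m) k⟩ := by
    rw [hdec, C.conjRoot_mul_apply hC]
    change MulAut.conjNormal (D.toTheta ((a ^ m : C.Huu) : D.PiTemp)) _ = _
    rw [ThetaSetting.conjNormal_eq_of_aug_eq_one ham]
  have key' : C.conjRoot hC (a ^ m) f.1 k = f.1 ⟨_, C.conj_mem_GtpYdduu hC (a ^ m) k⟩ := by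
    change MulAut.conjNormal (D.toTheta ((a ^ m : C.Huu) : D.PiTemp)) _ = _
    rw [ThetaSetting.conjNormal_eq_of_aug_eq_one ham]
  have e1 : (⟨(C.conjRoot hC (a ^ m') f.1 k : D.GtpTheta), (D.lDeltaTheta_normal l).conj_mem _ (hf.1 _) _⟩ :
      D.lDeltaTheta l) = ⟨(C.conjRoot hC ((a ^ t) ^ ((M : ℕ+) : ℕ)) f.1 ⟨_, C.conj_mem_GtpYdduu hC (a ^ m) k⟩ :
        D.GtpTheta), (D.lDeltaTheta_normal l).conj_mem _ (hf.1 _) _⟩ := by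
    apply Subtype.ext
    change ((C.conjRoot hC (a ^ m') f.1 k : D.DeltaTheta) : D.GtpTheta) =
      ((C.conjRoot hC ((a ^ t) ^ ((M : ℕ+) : ℕ)) f.1 ⟨_, C.conj_mem_GtpYdduu hC (a ^ m) k⟩ : D.DeltaTheta) : D.GtpTheta)
    rw [key]
  have e2 : (⟨(C.conjRoot hC (a ^ m) f.1 k : D.GtpTheta), (D.lDeltaTheta_normal l).conj_mem _ (hf.1 _) _⟩ :
      D.lDeltaTheta l) = ⟨(f.1 ⟨_, C.conj_mem_GtpYdduu hC (a ^ m) k⟩ : D.GtpTheta), hf.1 _⟩ := by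
    apply Subtype.ext
    change ((C.conjRoot hC (a ^ m) f.1 k : D.DeltaTheta) : D.GtpTheta) =
      ((f.1 ⟨_, C.conj_mem_GtpYdduu hC (a ^ m) k⟩ : D.DeltaTheta) : D.GtpTheta)
    rw [key']
  rw [e1, e2, hvan t _]

end ThetaSetting.EtaleThetaData.DoubleUnderline

namespace SettingModel

variable (p : ℕ) [Fact p.Prime] (i j : ℤ) (hj : Even j)

/-! ## §1. At the Tate model the iterated-commutator class `e = θ[σ⁻¹; σ⁻¹kσk⁻¹]` is a square in `l·Δ_Θ` -/

/-- **`θ[σ⁻¹; c₁] = s²` with `s ∈ l·Δ_Θ` at the stage-2 model**, for every `X̲̲`-choice `C`, every GEOMETRIC `σ ∈ Π^tp_X̲̲`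
(`aug σ = 1`) and EVERY `k ∈ Π^tp_Ÿ̲̲` (arithmetic elements included), where `c₁ := σ⁻¹kσk⁻¹`: the commutator `c₁` is a
geometric element of `Π^tp_Ÿ̲̲` (abc-iut-f-142's `conj_mul_inv_mem_GtpYdduu`, `ThetaSetting.aug_pow_comm_eq_one`), so
abc-iut-L1-t6's `exists_sq_eq_toTheta_comm_modelχq` (p487040: `deg σ ∈ l·ℤ`, `ŷ(c₁) ∈ 2Ẑ`) applies at the pair `(σ, c₁)`.
This is the square hypothesis of abc-iut-f-142's `red_conjRoot_pow_eq_of_sq` (p492018), discharged at the model.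
[cite: MochizukiEtTh2009, Cor 2.19(iii) p.65] -/
theorem exists_sq_eq_toTheta_conj_comm_modelχq {E : (ThetaSetting.modelχq p i j hj).EtaleThetaData} {l : ℕ}
    (C : E.DoubleUnderline l) (hC : (ThetaSetting.modelχq p i j hj).Compat) (σ : C.Huu)
    (hσ : (ThetaSetting.modelχq p i j hj).aug.toMonoidHom (σ : (ThetaSetting.modelχq p i j hj).PiTemp) = 1)
    (k : C.GtpYdduu) :
    ∃ s : (ThetaSetting.modelχq p i j hj).lDeltaTheta l,
      (s : (ThetaSetting.modelχq p i j hj).GtpTheta) ^ 2 =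
        (ThetaSetting.modelχq p i j hj).toTheta
          ((σ : (ThetaSetting.modelχq p i j hj).PiTemp)⁻¹ *
              ((σ : (ThetaSetting.modelχq p i j hj).PiTemp)⁻¹ * k * σ *
                (k : (ThetaSetting.modelχq p i j hj).PiTemp)⁻¹) * σ *
            ((σ : (ThetaSetting.modelχq p i j hj).PiTemp)⁻¹ * k * σ *
              (k : (ThetaSetting.modelχq p i j hj).PiTemp)⁻¹)⁻¹) := by
  -- the commutator `c₁ := σ⁻¹ k σ k⁻¹` as a geometric element of `Π^tp_Ÿ̲̲ ≤ Π^tp_X̲̲`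
  set c₁ : C.GtpYdduu := ⟨_, C.conj_mul_inv_mem_GtpYdduu hC σ k⟩ with hc₁
  have hc₁Huu : (c₁ : (ThetaSetting.modelχq p i j hj).PiTemp) ∈ C.Huu := (Subgroup.mem_inf.1 c₁.2).2
  have hc₁Ydd : (⟨(c₁ : (ThetaSetting.modelχq p i j hj).PiTemp), hc₁Huu⟩ : C.Huu) ∈
      (ThetaSetting.modelχq p i j hj).GtpYdd.subgroupOf C.Huu := by
    rw [Subgroup.mem_subgroupOf]
    exact (Subgroup.mem_inf.1 c₁.2).1
  have hc₁aug : (ThetaSetting.modelχq p i j hj).aug.toMonoidHom (c₁ : (ThetaSetting.modelχq p i j hj).PiTemp) = 1 := by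
    have h := (ThetaSetting.modelχq p i j hj).aug_pow_comm_eq_one
      (σ : (ThetaSetting.modelχq p i j hj).PiTemp) (k : (ThetaSetting.modelχq p i j hj).PiTemp) hσ 1
    rw [pow_one] at h
    exact h
  -- `θ[σ⁻¹; c₁] ∈ Δ_Θ`, hence `∈ l·Δ_Θ` (both `σ`, `c₁` lie in `Π^tp_X̲̲`)
  have hΔ : (ThetaSetting.modelχq p i j hj).toTheta
      ((σ : (ThetaSetting.modelχq p i j hj).PiTemp)⁻¹ * c₁ * σ *
        (c₁ : (ThetaSetting.modelχq p i j hj).PiTemp)⁻¹) ∈ (ThetaSetting.modelχq p i j hj).DeltaTheta :=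
    C.toTheta_conj_mul_inv_mem_DeltaTheta σ hσ c₁ hc₁aug
  have hHuu : (σ : (ThetaSetting.modelχq p i j hj).PiTemp)⁻¹ * c₁ * σ *
      (c₁ : (ThetaSetting.modelχq p i j hj).PiTemp)⁻¹ ∈ C.Huu :=
    C.Huu.mul_mem (C.Huu.mul_mem (C.Huu.mul_mem (C.Huu.inv_mem σ.2) hc₁Huu) σ.2) (C.Huu.inv_mem hc₁Huu)
  have h₁ : (ThetaSetting.modelχq p i j hj).toTheta
      (((σ : (ThetaSetting.modelχq p i j hj).PiTemp))⁻¹ *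
          (((⟨⟨(c₁ : (ThetaSetting.modelχq p i j hj).PiTemp), hc₁Huu⟩, hc₁Ydd⟩ :
              ↥((ThetaSetting.modelχq p i j hj).GtpYdd.subgroupOf C.Huu)) : C.Huu) :
            (ThetaSetting.modelχq p i j hj).PiTemp) *
          (σ : (ThetaSetting.modelχq p i j hj).PiTemp) *
        ((((⟨⟨(c₁ : (ThetaSetting.modelχq p i j hj).PiTemp), hc₁Huu⟩, hc₁Ydd⟩ :
              ↥((ThetaSetting.modelχq p i j hj).GtpYdd.subgroupOf C.Huu)) : C.Huu) :
            (ThetaSetting.modelχq p i j hj).PiTemp))⁻¹) ∈ (ThetaSetting.modelχq p i j hj).lDeltaTheta l :=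
    C.toTheta_mem_lDeltaTheta_of_mem_Huu hHuu hΔ
  obtain ⟨d, hd⟩ := exists_sq_eq_toTheta_comm_modelχq p i j hj C σ hσ
    ⟨⟨(c₁ : (ThetaSetting.modelχq p i j hj).PiTemp), hc₁Huu⟩, hc₁Ydd⟩ hc₁aug h₁
  refine ⟨d, ?_⟩
  have hd' := congrArg Subtype.val hd
  rw [Subgroup.coe_pow] at hd'
  exact hd'

/-! ## §2. The vanishing and the congruence transfer at EVERY level -/

/-- **(b2) PERIODICITY AT THE TATE MODEL, EVERY LEVEL: `red_M (conjRoot (σ^M) f k) = red_M (f k)`** for every `M ∈ E` (no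
parity), every root cocycle `f`, every geometric `σ ∈ Π^tp_X̲̲` and EVERY `k ∈ Π^tp_Ÿ̲̲` — abc-iut-f-142's square variant
`red_conjRoot_pow_eq_of_sq` (p492018) with its square binder discharged by §1. (At odd `M` this is also p491632's
`red_conjRoot_pow_eq_of_odd`; the content here is the EVEN levels.) [cite: MochizukiEtTh2009, Cor 2.19(iii) p.65] -/
theorem red_conjRoot_pow_eq_modelχq {E : (ThetaSetting.modelχq p i j hj).EtaleThetaData} {l : ℕ}
    (C : E.DoubleUnderline l) {Es : Set ℕ+} (τ : (ThetaSetting.modelχq p i j hj).CyclotomeTower l Es)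
    (hC : (ThetaSetting.modelχq p i j hj).Compat) (h15 : ThetaSetting.Prop15iii E hC)
    {f : contCocycles (ThetaSetting.modelχq p i j hj).toTheta (ThetaSetting.modelχq p i j hj).DeltaTheta C.GtpYdduu}
    (hf : f ∈ C.rootCocycles hC) (σ : C.Huu)
    (hσ : (ThetaSetting.modelχq p i j hj).aug.toMonoidHom (σ : (ThetaSetting.modelχq p i j hj).PiTemp) = 1)
    (k : C.GtpYdduu) (M : Es) :
    (τ.mod M).red ⟨(C.conjRoot hC (σ ^ ((M : ℕ+) : ℕ)) f.1 k : (ThetaSetting.modelχq p i j hj).GtpTheta),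
        ((ThetaSetting.modelχq p i j hj).lDeltaTheta_normal l).conj_mem _ (hf.1 _) _⟩ =
      (τ.mod M).red ⟨(f.1 k : (ThetaSetting.modelχq p i j hj).GtpTheta), hf.1 _⟩ := by
  obtain ⟨s, hs⟩ := exists_sq_eq_toTheta_conj_comm_modelχq p i j hj C hC σ hσ k
  exact C.red_conjRoot_pow_eq_of_sq τ hC h15 hf σ hσ k M s hs

/-- **CONGRUENT EXPONENTS GIVE THE SAME LEVEL-`M` REDUCTION AT THE TATE MODEL, EVERY LEVEL**: for `M ∈ E` (any parity), a
geometric `a ∈ Π^tp_X̲̲`, a root cocycle `f`, any `k ∈ Π^tp_Ÿ̲̲` and `m ≡ m′ (mod M)`: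
`red_M (conjRoot (a^{m′}) f k) = red_M (conjRoot (a^m) f k)` — abc-iut-f-142's `red_conjRoot_zpow_eq_of_modEq` argument
(`a^{m′} = a^m (a^t)^M`, action law `conjRoot_mul_apply`) with the vanishing of `red_conjRoot_pow_eq_modelχq` for `σ := a^t`.
[cite: MochizukiEtTh2009, Cor 2.19(iii) p.65] -/
theorem red_conjRoot_zpow_eq_of_modEq_modelχq {E : (ThetaSetting.modelχq p i j hj).EtaleThetaData} {l : ℕ}
    (C : E.DoubleUnderline l) {Es : Set ℕ+} (τ : (ThetaSetting.modelχq p i j hj).CyclotomeTower l Es)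
    (hC : (ThetaSetting.modelχq p i j hj).Compat) (h15 : ThetaSetting.Prop15iii E hC)
    {f : contCocycles (ThetaSetting.modelχq p i j hj).toTheta (ThetaSetting.modelχq p i j hj).DeltaTheta C.GtpYdduu}
    (hf : f ∈ C.rootCocycles hC) (a : C.Huu)
    (ha : (ThetaSetting.modelχq p i j hj).aug.toMonoidHom (a : (ThetaSetting.modelχq p i j hj).PiTemp) = 1)
    (k : C.GtpYdduu) (M : Es) {m m' : ℤ} (hmm' : m ≡ m' [ZMOD ((M : ℕ+) : ℕ)]) :
    (τ.mod M).red ⟨(C.conjRoot hC (a ^ m') f.1 k : (ThetaSetting.modelχq p i j hj).GtpTheta),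
        ((ThetaSetting.modelχq p i j hj).lDeltaTheta_normal l).conj_mem _ (hf.1 _) _⟩ =
      (τ.mod M).red ⟨(C.conjRoot hC (a ^ m) f.1 k : (ThetaSetting.modelχq p i j hj).GtpTheta),
        ((ThetaSetting.modelχq p i j hj).lDeltaTheta_normal l).conj_mem _ (hf.1 _) _⟩ := by
  refine C.red_conjRoot_zpow_eq_of_modEq_of_vanishing τ hC hf a ha k M (fun t k' => ?_) hmm'
  have hat : (ThetaSetting.modelχq p i j hj).aug.toMonoidHom
      ((a ^ t : C.Huu) : (ThetaSetting.modelχq p i j hj).PiTemp) = 1 := by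
    rw [Subgroup.coe_zpow, map_zpow, ha, one_zpow]
  exact red_conjRoot_pow_eq_modelχq p i j hj C τ hC h15 hf (a ^ t) hat k' M

/-! ## §3. The (b2) clause of `cor219_iii_of_hearts` at the Tate datum for any mod-compatible exponent family -/

/-- **(b2) LEVEL COMPATIBILITY AT THE TATE MODEL for level-DEPENDENT conjugators `x_M := a^{m_M}`**, with NO parity and NO
`hgen` condition: if the exponent family is compatible (`m M′ ≡ m M (mod M)` whenever `M ∣ M′` — the shape abc-iut-f-142's
compatible-exponent choice produces), then for every pair `M ∣ M′` in `E` and EVERY `g ∈ Π^tp_Ÿ̲̲` (arithmetic included)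
`red_M (conjRoot (a^{m M′}) f₀ g) = red_M (conjRoot (a^{m M}) f₀ g)` — the clause (b2) of abc-iut-C-hgal-2's
`cor219_iii_of_hearts` (p482618, l.106–110) VERBATIM for `x M := a^{m M}`, at `modelχq p i j` (`j` even), every `E`, every
`X̲̲`-choice `C`, every tower `τ`, every root cocycle `f₀`, every geometric `a ∈ Π^tp_X̲̲`.
[cite: MochizukiEtTh2009, Cor 2.19(iii) p.65] -/
theorem levelCompat_of_compatible_modelχq {E : (ThetaSetting.modelχq p i j hj).EtaleThetaData} {l : ℕ}
    (C : E.DoubleUnderline l) {Es : Set ℕ+} (τ : (ThetaSetting.modelχq p i j hj).CyclotomeTower l Es)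
    (hC : (ThetaSetting.modelχq p i j hj).Compat) (hS : (ThetaSetting.modelχq p i j hj).Sec2Hyps)
    (h15 : ThetaSetting.Prop15iii E hC)
    {f₀ : contCocycles (ThetaSetting.modelχq p i j hj).toTheta (ThetaSetting.modelχq p i j hj).DeltaTheta C.GtpYdduu}
    (hf₀ : f₀ ∈ C.rootCocycles hC) (a : C.Huu)
    (ha : (ThetaSetting.modelχq p i j hj).aug.toMonoidHom (a : (ThetaSetting.modelχq p i j hj).PiTemp) = 1)
    (m : Es → ℤ) (hm : ∀ M M' : Es, ((M : ℕ+) ∣ M') → m M' ≡ m M [ZMOD ((M : ℕ+) : ℕ)]) :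
    ∀ (M M' : Es), ((M : ℕ+) ∣ M') → ∀ g : (C.thetaEnvTower τ hC hS).PiYdd,
      (τ.mod M).red ⟨(C.conjRoot hC (a ^ m M') f₀.1 (C.inclYdduu g) : (ThetaSetting.modelχq p i j hj).GtpTheta),
          ((ThetaSetting.modelχq p i j hj).lDeltaTheta_normal l).conj_mem _ (hf₀.1 _) _⟩ =
        (τ.mod M).red ⟨(C.conjRoot hC (a ^ m M) f₀.1 (C.inclYdduu g) : (ThetaSetting.modelχq p i j hj).GtpTheta),
          ((ThetaSetting.modelχq p i j hj).lDeltaTheta_normal l).conj_mem _ (hf₀.1 _) _⟩ :=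
  fun M M' hMM' g =>
    red_conjRoot_zpow_eq_of_modEq_modelχq p i j hj C τ hC h15 hf₀ a ha (C.inclYdduu g) M (hm M M' hMM').symm

end SettingModel

end Literature.AnabelianGeometry.EtaleTheta

end
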